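import Literature.AlgebraicGeometry.RelativeSpec.GluedQuotientDescendedAction
import Literature.AlgebraicGeometry.Motives.IntegralModelTameQuotientSmoothProper
import HarnessLib

/-!
# The tame quotient of a smooth proper relative curve over `𝒪_{K,(v)}` by `Γ`, WITH the descended action of a commuting `G`
# (SGA 1 V 1.5 ∕ 1.9; Katz–Mazur A7.1; Mumford AV §7 — proofs only)

Topic `AlgebraicGeometry/Motives` (integral models); namespace `Literature.AlgebraicGeometry.Motives`. THEOREMS ONLY (no definition,
no named fact, no instance, no notation, no `sorry`). Cell `pub/hodgecm-mathlib`, P6 «MOD programme», LEAD F0P6-plan ruling M-2c, letter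
GALQ (`F0P6aModuliDatum.RecordGaloisQuotientDescent`, «the tame Galois quotient descends the model AND the level action»): the
generic half = ★ `IntegralModel.exists_tameQuotient_isSmoothProper_one` (A-p14, hand M-Q) EXTENDED by the descended action of a second
group (★ `ActionOver.descAction`, `GluedQuotientDescendedAction`).

## Mathematics
`K` a number field, `v` a finite place, `𝒪 = 𝒪_{K,(v)}`; `𝒳₁` an integral model over `𝒪` of the `K`-scheme `X₁`, smooth of relative
dimension `1` and proper; `θ` an action of `Γ × G` (`Γ` finite of order invertible in `𝒪`) on `𝒳₁` over `Spec 𝒪` with every point in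
a `θ`-stable open affine over `𝒪`; `τ` an action of `Γ × G` on `X₁` over `K` agreeing with `θ` on the generic fibre through
`𝒳₁.genericIso'`; `q : X₁ → X` a geometric quotient BY `Γ` over `K`, `X` separated over `K`.  THEN `𝒳 := 𝒳₁ ∕ Γ` (★ glued quotient)
is a smooth proper integral model of `X` of relative dimension `1`, the `G`-action DESCENDS to an action `ρ` on `𝒳` over `Spec 𝒪` with
every point in a `ρ`-stable open affine over `𝒪`, the quotient map `ū : 𝒳₁ → 𝒳` intertwines `θ(1, g)` and `ρ(g)`, its generic
fibre is `q` through the two `genericIso'`, and any endomorphism `t` of `X` with `τ(1, g) ≫ q = q ≫ t` IS the generic fibre of `ρ(g)`.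

* `IntegralModel.exists_tameQuotient_descAction` — the statement above (the integral half of GALQ, generic in the record data);
* `IntegralModel.exists_tameQuotient_descAction_inv` (ED. 2) — the same with the `Γ`-invariance of `ū` as an extra conjunct.

## References
* [SGA1] A. Grothendieck, SGA 1, Exp. V §1, Prop. 1.1, 1.8, 1.9, Cor. 1.5.
* [KatzMazur1985] N. M. Katz, B. Mazur, *Arithmetic Moduli of Elliptic Curves*, A7.1 (tame quotients of smooth curves).
* [MumfordAV1970] D. Mumford, *Abelian Varieties* (1970), §7 Thm. p. 66 and Remark (universal property; commuting automorphisms descend).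
-/

set_option autoImplicit false

noncomputable section

open CategoryTheory CategoryTheory.Limits AlgebraicGeometry IsDedekindDomain IsDedekindDomain.HeightOneSpectrum
open scoped NumberField

namespace Literature.AlgebraicGeometry.Motives

open Literature.AlgebraicGeometry.RelativeSpec
open Literature.AlgebraicGeometry.RelativeSpec.ActionOver (fstAction sndAction descAction)
open Literature.NumberTheory.EllipticCurves (genericFibre specGenericPoint)

universe u

/-! ## §1 Plumbing over the base `Spec 𝒪_{K,(v)}` (private copies of ★ `IntegralModelTameQuotientSmoothProper` §1) -/

section Base

variable {K : Type} [Field K] [NumberField K] (v : HeightOneSpectrum (𝓞 K))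

/-- `K` is flat over `𝒪_{K,(v)}` (private plumbing). [folklore] -/
private theorem flat_valuationSubringAtPrime' : Module.Flat (valuationSubringAtPrime K v) K :=
  IsLocalization.flat K (nonZeroDivisors (valuationSubringAtPrime K v))

/-- An integer invertible in `𝒪_{K,(v)}` is invertible in `Γ(Spec 𝒪_{K,(v)}, 𝒪)` (private plumbing). [folklore] -/
private theorem isUnit_natCast_sections_of_isUnit' (n : ℕ) (hn : IsUnit ((n : ℕ) : valuationSubringAtPrime K v)) :
    IsUnit ((n : ℕ) : Γ(Spec (CommRingCat.of (valuationSubringAtPrime K v)), ⊤)) := by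
  have h := hn.map (Scheme.ΓSpecIso (CommRingCat.of (valuationSubringAtPrime K v))).inv.hom
  rwa [map_natCast] at h

end Base

/-! ## §2 The generic fibre of a base change: naturality of `pullback.fst` -/

section Fst

variable {R : Type u} [CommRing R] {L : Type u} [Field L] [Algebra R L]

/-- `(f ×_R L) ≫ pr₁ = pr₁ ≫ f` for a morphism `f` of `R`-schemes (Mathlib `pullback.lift_fst`). [folklore] -/
private theorem baseChange_map_left_fst {A B : SchemeOver R} (f : A ⟶ B) :
    ((baseChange R L).map f).left ≫ pullback.fst B.hom (Spec.map (CommRingCat.ofHom (algebraMap R L))) =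
      pullback.fst A.hom (Spec.map (CommRingCat.ofHom (algebraMap R L))) ≫ f.left :=
  pullback.lift_fst _ _ _

end Fst

/-! ## §3 The tame quotient with the descended action -/

section TameQuotientDesc

variable {K : Type} [Field K] [NumberField K] {v : HeightOneSpectrum (𝓞 K)}
  {Γ G : Type} [Group Γ] [Finite Γ] [Group G] {X₁ X : SchemeOver K}

set_option backward.isDefEq.respectTransparency false

set_option maxHeartbeats 800000 in
/-- **The tame quotient by `Γ` of a smooth proper model of relative dimension `1` over `𝒪_{K,(v)}`, with the descended action of a
commuting group `G`.**  See the module docstring.  Inputs: `𝒳₁` smooth of relative dimension `1` and proper; `θ : ActionOver 𝒳₁.total.hom (Γ × G)`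
with Mumford's cover `hcovθ`; `|Γ| ∈ 𝒪ˣ`; `τ : ActionOver X₁.hom (Γ × G)` compatible with `θ` through `genericIso'` (`hθτ`); `q : X₁ ⟶ X` a
geometric quotient by the `Γ`-part of `τ`, `X` separated over `K`.  Outputs: the model `𝒳` (`IsSmoothProper 1`), the descended action `ρ`
of `G` on `𝒳` over `Spec 𝒪` with its stable affine cover, the quotient map `ū` (intertwining `θ(1,g)` with `ρ g`; generic fibre `q`), and the
generic reading of `ρ`: every `t : X ⟶ X` with `τ(1,g) ≫ q = q ≫ t` is the generic fibre of `ρ g` through `𝒳.genericIso'`.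
(★ `exists_tameQuotient_isSmoothProper_one`'s construction — SGA 1 V 1.9 ∕ 1.5, Katz–Mazur A7.1 over the base `Spec 𝒪_{K,(v)}` with perfect
residue fields — run with the quotient kept EXPLICIT as `𝒳₁ ∕ Γ = ρ_Γ.glued`, so that ★ `ActionOver.descAction` applies.)
[cite: KatzMazur1985, A7.1] [cite: SGA1, Exp. V Prop. 1.9] [cite: MumfordAV1970, §7 Thm. p. 66 (Remark)] -/
theorem IntegralModel.exists_tameQuotient_descAction
    (𝒳₁ : IntegralModel (valuationSubringAtPrime K v) K X₁) (h𝒳₁ : 𝒳₁.IsSmoothProper 1)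
    (θ : ActionOver 𝒳₁.total.hom (Γ × G)) (hcovθ : ∀ x : ↥𝒳₁.total.left, ∃ O : θ.StableAffineOpens, x ∈ O.1)
    (hcardΓ : IsUnit ((Nat.card Γ : ℕ) : valuationSubringAtPrime K v))
    [IsSeparated X.hom] (τ : ActionOver X₁.hom (Γ × G))
    (hθτ : ∀ a : Γ × G,
      (genericFibre (valuationSubringAtPrime K v) K).map (Over.isoMk (θ.aut a) (θ.aut_comp a)).hom ≫ 𝒳₁.genericIso'.hom
        = 𝒳₁.genericIso'.hom ≫ (Over.isoMk (τ.aut a) (τ.aut_comp a)).hom)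
    (q : X₁ ⟶ X) (hq : (fstAction τ).IsGeometricQuotient q.left) :
    ∃ (𝒳 : IntegralModel (valuationSubringAtPrime K v) K X) (_ : 𝒳.IsSmoothProper 1)
      (ρ : ActionOver 𝒳.total.hom G) (_ : ∀ x : ↥𝒳.total.left, ∃ O : ρ.StableAffineOpens, x ∈ O.1)
      (ū : 𝒳₁.total ⟶ 𝒳.total),
      (∀ g : G, (θ.aut (1, g)).hom ≫ ū.left = ū.left ≫ (ρ.aut g).hom) ∧
      (genericFibre (valuationSubringAtPrime K v) K).map ū ≫ 𝒳.genericIso'.hom = 𝒳₁.genericIso'.hom ≫ q ∧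
      (∀ (g : G) (t : X ⟶ X), (τ.aut (1, g)).hom ≫ q.left = q.left ≫ t.left →
        (genericFibre (valuationSubringAtPrime K v) K).map (Over.isoMk (ρ.aut g) (ρ.aut_comp g)).hom ≫ 𝒳.genericIso'.hom
          = 𝒳.genericIso'.hom ≫ t) := by
  -- abbreviations
  haveI : Module.Flat (valuationSubringAtPrime K v) K := flat_valuationSubringAtPrime' v
  haveI : IsProper 𝒳₁.total.hom := h𝒳₁.2
  haveI : SmoothOfRelativeDimension 1 𝒳₁.total.hom := h𝒳₁.1
  haveI : IsSeparated 𝒳₁.total.hom := inferInstance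
  let ρΓ : ActionOver 𝒳₁.total.hom Γ := fstAction θ
  let σG : ActionOver 𝒳₁.total.hom G := sndAction θ
  have hcovΓ : ∀ x : ↥𝒳₁.total.left, ∃ O : ρΓ.StableAffineOpens, x ∈ O.1 := ActionOver.hcov_fstAction θ hcovθ
  have hcomm : ∀ (γ : Γ) (g : G), (ρΓ.aut γ).hom ≫ (σG.aut g).hom = (σG.aut g).hom ≫ (ρΓ.aut γ).hom :=
    ActionOver.fstAction_comm_sndAction θ
  -- the generic fibre of `𝒳₁` as a bare scheme, identified with `X₁`
  let eL : ((baseChange (valuationSubringAtPrime K v) K).obj 𝒳₁.total).left ≅ X₁.left :=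
    (Over.forget (Spec (CommRingCat.of K))).mapIso 𝒳₁.genericIso
  -- the generic `Γ × G`-action in `pullback.fst` currency: `τ a ∘ eL = eL ∘ (θ a)_K`
  have hτθ : ∀ a : Γ × G,
      ((baseChange (valuationSubringAtPrime K v) K).map (Over.isoMk (θ.aut a) (θ.aut_comp a)).hom).left ≫ eL.hom = eL.hom ≫ (τ.aut a).hom := by
    intro a
    have h := congrArg (fun f => f.left) (hθτ a)
    simp only [Over.comp_left] at h
    exact h
  -- the `Γ`-action transported to the generic fibre of `𝒳₁`
  let σ₀aut : Γ →* Aut ((baseChange (valuationSubringAtPrime K v) K).obj 𝒳₁.total).left :=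
    eL.symm.conjAut.toMonoidHom.comp (fstAction τ).aut
  have hσ₀aut : ∀ γ : Γ, (σ₀aut γ).hom = eL.hom ≫ (τ.aut (γ, 1)).hom ≫ eL.inv := fun γ => by
    change (eL.symm.conjAut ((fstAction τ).aut γ)).hom = _
    rw [Iso.conjAut_hom, Iso.conj_apply]
    rfl
  -- which IS the generic fibre of `θ(γ,1)`
  have hσ₀eq : ∀ γ : Γ, (σ₀aut γ).hom = ((baseChange (valuationSubringAtPrime K v) K).map (Over.isoMk (θ.aut (γ, 1)) (θ.aut_comp (γ, 1))).hom).left := by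
    intro γ
    rw [hσ₀aut, ← reassoc_of% (hτθ (γ, 1)), eL.hom_inv_id, Category.comp_id]
  have hσ₀_comp : ∀ γ : Γ, (σ₀aut γ).hom ≫ ((baseChange (valuationSubringAtPrime K v) K).obj 𝒳₁.total).hom = ((baseChange (valuationSubringAtPrime K v) K).obj 𝒳₁.total).hom := by
    intro γ; rw [hσ₀eq]; exact Over.w _
  let σ₀ : ActionOver ((baseChange (valuationSubringAtPrime K v) K).obj 𝒳₁.total).hom Γ := ⟨σ₀aut, hσ₀_comp⟩
  have hσ₀ : ∀ γ : Γ, (σ₀.aut γ).hom ≫ pullback.fst 𝒳₁.total.hom (Spec.map (CommRingCat.ofHom (algebraMap (valuationSubringAtPrime K v) K))) =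
      pullback.fst 𝒳₁.total.hom (Spec.map (CommRingCat.ofHom (algebraMap (valuationSubringAtPrime K v) K))) ≫ (ρΓ.aut γ).hom := by
    intro γ
    change (σ₀aut γ).hom ≫ _ = _
    rw [hσ₀eq, baseChange_map_left_fst]
    rfl
  -- `eL ≫ q` is a geometric quotient of the generic fibre of `𝒳₁` by `σ₀`
  have he : ∀ γ : Γ, eL.hom ≫ ((fstAction τ).aut γ).hom = (σ₀.aut γ).hom ≫ eL.hom := fun γ => by
    change eL.hom ≫ (τ.aut (γ, 1)).hom = (σ₀aut γ).hom ≫ eL.hom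
    rw [hσ₀aut, Category.assoc, Category.assoc, eL.inv_hom_id, Category.comp_id]
  have hq₀ : σ₀.IsGeometricQuotient (eL.hom ≫ q.left) := hq.of_equivariantIso σ₀ eL he
  -- THE QUOTIENT, explicit: `𝒳₁ ∕ Γ`
  let Q : SchemeOver (valuationSubringAtPrime K v) := Over.mk (ρΓ.gluedDesc 𝒳₁.total.hom ρΓ.aut_comp)
  let ū : 𝒳₁.total ⟶ Q := Over.homMk (ρΓ.gluedMk hcovΓ) (ρΓ.gluedMk_gluedDesc hcovΓ 𝒳₁.total.hom ρΓ.aut_comp)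
  have hq₁ : σ₀.IsGeometricQuotient ((baseChange (valuationSubringAtPrime K v) K).map ū).left :=
    isGeometricQuotient_baseChange_gluedMk_of_flat 𝒳₁.total ρΓ hcovΓ K σ₀ hσ₀
  haveI : IsSeparated (ρΓ.gluedDesc 𝒳₁.total.hom ρΓ.aut_comp) := ρΓ.isSeparated_gluedDesc hcovΓ 𝒳₁.total.hom ρΓ.aut_comp
  haveI : IsSeparated ((baseChange (valuationSubringAtPrime K v) K).obj Q).hom := by
    change IsSeparated (pullback.snd (ρΓ.gluedDesc 𝒳₁.total.hom ρΓ.aut_comp) _)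
    infer_instance
  haveI hsep₁ : ((baseChange (valuationSubringAtPrime K v) K).obj Q).left.IsSeparated :=
    ⟨by rw [← terminal.comp_from ((baseChange (valuationSubringAtPrime K v) K).obj Q).hom]; infer_instance⟩
  haveI hsep₂ : X.left.IsSeparated := ⟨by rw [← terminal.comp_from X.hom]; infer_instance⟩
  -- the canonical isomorphism of geometric quotients over `K`
  let e : ((baseChange (valuationSubringAtPrime K v) K).obj Q).left ≅ X.left := hq₁.uniqueUpToIso hq₀
  have he₁ : ((baseChange (valuationSubringAtPrime K v) K).map ū).left ≫ e.hom = eL.hom ≫ q.left := hq₁.comp_uniqueUpToIso_hom hq₀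
  have heX : e.hom ≫ X.hom = ((baseChange (valuationSubringAtPrime K v) K).obj Q).hom := by
    apply hq₁.desc_unique
    rw [reassoc_of% he₁, Over.w q,
      show eL.hom ≫ X₁.hom = ((baseChange (valuationSubringAtPrime K v) K).obj 𝒳₁.total).hom from Over.w 𝒳₁.genericIso.hom]
    exact (Over.w ((baseChange (valuationSubringAtPrime K v) K).map ū)).symm
  let 𝒳 : IntegralModel (valuationSubringAtPrime K v) K X := ⟨Q, Over.isoMk e heX⟩
  -- smooth and proper
  have hsp : 𝒳.IsSmoothProper 1 :=
    ρΓ.smoothOfRelativeDimension_one_and_isProper_gluedDesc_of_isUnit_card hcovΓ h𝒳₁.2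
      (isUnit_natCast_sections_of_isUnit' v (Nat.card Γ) hcardΓ)
      (perfectField_residueField_spec_valuationSubringAtPrime v)
  -- the descended `G`-action and its cover
  let ρ : ActionOver 𝒳.total.hom G := descAction ρΓ hcovΓ σG hcomm
  have hcovρ : ∀ x : ↥𝒳.total.left, ∃ O : ρ.StableAffineOpens, x ∈ O.1 :=
    ActionOver.exists_stableAffineOpen_descAction ρΓ hcovΓ σG hcomm (ActionOver.hcov₂_of_prod θ hcovθ)
  have hinter : ∀ g : G, (θ.aut (1, g)).hom ≫ ū.left = ū.left ≫ (ρ.aut g).hom := fun g =>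
    ActionOver.aut_hom_gluedMk_descAction ρΓ hcovΓ σG hcomm g
  -- the generic square
  have hsq : (genericFibre (valuationSubringAtPrime K v) K).map ū ≫ 𝒳.genericIso'.hom = 𝒳₁.genericIso'.hom ≫ q := by
    ext : 1
    rw [Over.comp_left, Over.comp_left]
    change ((baseChange (valuationSubringAtPrime K v) K).map ū).left ≫ e.hom = eL.hom ≫ q.left
    exact he₁
  refine ⟨𝒳, hsp, ρ, hcovρ, ū, hinter, hsq, fun g t ht => ?_⟩
  -- the generic reading of `ρ g`: precompose with the epimorphism `ū_K` (a geometric quotient)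
  ext : 1
  rw [Over.comp_left, Over.comp_left]
  change ((baseChange (valuationSubringAtPrime K v) K).map (Over.isoMk (ρ.aut g) (ρ.aut_comp g)).hom).left ≫ e.hom = e.hom ≫ t.left
  apply hq₁.desc_unique
  -- LHS: `ū_K ≫ (ρ g)_K ≫ e = (θ(1,g))_K ≫ ū_K ≫ e = (θ(1,g))_K ≫ eL ≫ q = eL ≫ τ(1,g) ≫ q = eL ≫ q ≫ t`
  have h1 : ((baseChange (valuationSubringAtPrime K v) K).map ū).left ≫ ((baseChange (valuationSubringAtPrime K v) K).map (Over.isoMk (ρ.aut g) (ρ.aut_comp g)).hom).left =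
      ((baseChange (valuationSubringAtPrime K v) K).map (Over.isoMk (θ.aut (1, g)) (θ.aut_comp (1, g))).hom).left ≫ ((baseChange (valuationSubringAtPrime K v) K).map ū).left := by
    rw [← Over.comp_left, ← Over.comp_left, ← Functor.map_comp, ← Functor.map_comp]
    congr 2
    ext : 1
    rw [Over.comp_left, Over.comp_left]
    exact (hinter g).symm
  rw [reassoc_of% h1, he₁, ← Category.assoc, hτθ (1, g), Category.assoc, ht, reassoc_of% he₁]

set_option maxHeartbeats 800000 in
/-- **ED. 2 (LEAD F0P6-plan M-4 (2)): the same, with the `Γ`-INVARIANCE of the quotient map `ū` as an extra output conjunct**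
(`∀ γ, θ(γ,1) ≫ ū = ū` — the invariance of ★ `gluedMk`; the GALQ letter of P6a cand v2 0fd3fb4e carries it as `_hπqΓ`).  See the module docstring.  Inputs: `𝒳₁` smooth of relative dimension `1` and proper; `θ : ActionOver 𝒳₁.total.hom (Γ × G)`
with Mumford's cover `hcovθ`; `|Γ| ∈ 𝒪ˣ`; `τ : ActionOver X₁.hom (Γ × G)` compatible with `θ` through `genericIso'` (`hθτ`); `q : X₁ ⟶ X` a
geometric quotient by the `Γ`-part of `τ`, `X` separated over `K`.  Outputs: the model `𝒳` (`IsSmoothProper 1`), the descended action `ρ`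
of `G` on `𝒳` over `Spec 𝒪` with its stable affine cover, the quotient map `ū` (intertwining `θ(1,g)` with `ρ g`; generic fibre `q`), and the
generic reading of `ρ`: every `t : X ⟶ X` with `τ(1,g) ≫ q = q ≫ t` is the generic fibre of `ρ g` through `𝒳.genericIso'`.
(★ `exists_tameQuotient_isSmoothProper_one`'s construction — SGA 1 V 1.9 ∕ 1.5, Katz–Mazur A7.1 over the base `Spec 𝒪_{K,(v)}` with perfect
residue fields — run with the quotient kept EXPLICIT as `𝒳₁ ∕ Γ = ρ_Γ.glued`, so that ★ `ActionOver.descAction` applies.)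
[cite: KatzMazur1985, A7.1] [cite: SGA1, Exp. V Prop. 1.9] [cite: MumfordAV1970, §7 Thm. p. 66 (Remark)] -/
theorem IntegralModel.exists_tameQuotient_descAction_inv
    (𝒳₁ : IntegralModel (valuationSubringAtPrime K v) K X₁) (h𝒳₁ : 𝒳₁.IsSmoothProper 1)
    (θ : ActionOver 𝒳₁.total.hom (Γ × G)) (hcovθ : ∀ x : ↥𝒳₁.total.left, ∃ O : θ.StableAffineOpens, x ∈ O.1)
    (hcardΓ : IsUnit ((Nat.card Γ : ℕ) : valuationSubringAtPrime K v))
    [IsSeparated X.hom] (τ : ActionOver X₁.hom (Γ × G))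
    (hθτ : ∀ a : Γ × G,
      (genericFibre (valuationSubringAtPrime K v) K).map (Over.isoMk (θ.aut a) (θ.aut_comp a)).hom ≫ 𝒳₁.genericIso'.hom
        = 𝒳₁.genericIso'.hom ≫ (Over.isoMk (τ.aut a) (τ.aut_comp a)).hom)
    (q : X₁ ⟶ X) (hq : (fstAction τ).IsGeometricQuotient q.left) :
    ∃ (𝒳 : IntegralModel (valuationSubringAtPrime K v) K X) (_ : 𝒳.IsSmoothProper 1)
      (ρ : ActionOver 𝒳.total.hom G) (_ : ∀ x : ↥𝒳.total.left, ∃ O : ρ.StableAffineOpens, x ∈ O.1)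
      (ū : 𝒳₁.total ⟶ 𝒳.total),
      (∀ γ : Γ, (θ.aut (γ, 1)).hom ≫ ū.left = ū.left) ∧
      (∀ g : G, (θ.aut (1, g)).hom ≫ ū.left = ū.left ≫ (ρ.aut g).hom) ∧
      (genericFibre (valuationSubringAtPrime K v) K).map ū ≫ 𝒳.genericIso'.hom = 𝒳₁.genericIso'.hom ≫ q ∧
      (∀ (g : G) (t : X ⟶ X), (τ.aut (1, g)).hom ≫ q.left = q.left ≫ t.left →
        (genericFibre (valuationSubringAtPrime K v) K).map (Over.isoMk (ρ.aut g) (ρ.aut_comp g)).hom ≫ 𝒳.genericIso'.hom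
          = 𝒳.genericIso'.hom ≫ t) := by
  -- abbreviations
  haveI : Module.Flat (valuationSubringAtPrime K v) K := flat_valuationSubringAtPrime' v
  haveI : IsProper 𝒳₁.total.hom := h𝒳₁.2
  haveI : SmoothOfRelativeDimension 1 𝒳₁.total.hom := h𝒳₁.1
  haveI : IsSeparated 𝒳₁.total.hom := inferInstance
  let ρΓ : ActionOver 𝒳₁.total.hom Γ := fstAction θ
  let σG : ActionOver 𝒳₁.total.hom G := sndAction θ
  have hcovΓ : ∀ x : ↥𝒳₁.total.left, ∃ O : ρΓ.StableAffineOpens, x ∈ O.1 := ActionOver.hcov_fstAction θ hcovθ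
  have hcomm : ∀ (γ : Γ) (g : G), (ρΓ.aut γ).hom ≫ (σG.aut g).hom = (σG.aut g).hom ≫ (ρΓ.aut γ).hom :=
    ActionOver.fstAction_comm_sndAction θ
  -- the generic fibre of `𝒳₁` as a bare scheme, identified with `X₁`
  let eL : ((baseChange (valuationSubringAtPrime K v) K).obj 𝒳₁.total).left ≅ X₁.left :=
    (Over.forget (Spec (CommRingCat.of K))).mapIso 𝒳₁.genericIso
  -- the generic `Γ × G`-action in `pullback.fst` currency: `τ a ∘ eL = eL ∘ (θ a)_K`
  have hτθ : ∀ a : Γ × G,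
      ((baseChange (valuationSubringAtPrime K v) K).map (Over.isoMk (θ.aut a) (θ.aut_comp a)).hom).left ≫ eL.hom = eL.hom ≫ (τ.aut a).hom := by
    intro a
    have h := congrArg (fun f => f.left) (hθτ a)
    simp only [Over.comp_left] at h
    exact h
  -- the `Γ`-action transported to the generic fibre of `𝒳₁`
  let σ₀aut : Γ →* Aut ((baseChange (valuationSubringAtPrime K v) K).obj 𝒳₁.total).left :=
    eL.symm.conjAut.toMonoidHom.comp (fstAction τ).aut
  have hσ₀aut : ∀ γ : Γ, (σ₀aut γ).hom = eL.hom ≫ (τ.aut (γ, 1)).hom ≫ eL.inv := fun γ => by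
    change (eL.symm.conjAut ((fstAction τ).aut γ)).hom = _
    rw [Iso.conjAut_hom, Iso.conj_apply]
    rfl
  -- which IS the generic fibre of `θ(γ,1)`
  have hσ₀eq : ∀ γ : Γ, (σ₀aut γ).hom = ((baseChange (valuationSubringAtPrime K v) K).map (Over.isoMk (θ.aut (γ, 1)) (θ.aut_comp (γ, 1))).hom).left := by
    intro γ
    rw [hσ₀aut, ← reassoc_of% (hτθ (γ, 1)), eL.hom_inv_id, Category.comp_id]
  have hσ₀_comp : ∀ γ : Γ, (σ₀aut γ).hom ≫ ((baseChange (valuationSubringAtPrime K v) K).obj 𝒳₁.total).hom = ((baseChange (valuationSubringAtPrime K v) K).obj 𝒳₁.total).hom := by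
    intro γ; rw [hσ₀eq]; exact Over.w _
  let σ₀ : ActionOver ((baseChange (valuationSubringAtPrime K v) K).obj 𝒳₁.total).hom Γ := ⟨σ₀aut, hσ₀_comp⟩
  have hσ₀ : ∀ γ : Γ, (σ₀.aut γ).hom ≫ pullback.fst 𝒳₁.total.hom (Spec.map (CommRingCat.ofHom (algebraMap (valuationSubringAtPrime K v) K))) =
      pullback.fst 𝒳₁.total.hom (Spec.map (CommRingCat.ofHom (algebraMap (valuationSubringAtPrime K v) K))) ≫ (ρΓ.aut γ).hom := by
    intro γ
    change (σ₀aut γ).hom ≫ _ = _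
    rw [hσ₀eq, baseChange_map_left_fst]
    rfl
  -- `eL ≫ q` is a geometric quotient of the generic fibre of `𝒳₁` by `σ₀`
  have he : ∀ γ : Γ, eL.hom ≫ ((fstAction τ).aut γ).hom = (σ₀.aut γ).hom ≫ eL.hom := fun γ => by
    change eL.hom ≫ (τ.aut (γ, 1)).hom = (σ₀aut γ).hom ≫ eL.hom
    rw [hσ₀aut, Category.assoc, Category.assoc, eL.inv_hom_id, Category.comp_id]
  have hq₀ : σ₀.IsGeometricQuotient (eL.hom ≫ q.left) := hq.of_equivariantIso σ₀ eL he
  -- THE QUOTIENT, explicit: `𝒳₁ ∕ Γ`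
  let Q : SchemeOver (valuationSubringAtPrime K v) := Over.mk (ρΓ.gluedDesc 𝒳₁.total.hom ρΓ.aut_comp)
  let ū : 𝒳₁.total ⟶ Q := Over.homMk (ρΓ.gluedMk hcovΓ) (ρΓ.gluedMk_gluedDesc hcovΓ 𝒳₁.total.hom ρΓ.aut_comp)
  have hq₁ : σ₀.IsGeometricQuotient ((baseChange (valuationSubringAtPrime K v) K).map ū).left :=
    isGeometricQuotient_baseChange_gluedMk_of_flat 𝒳₁.total ρΓ hcovΓ K σ₀ hσ₀
  haveI : IsSeparated (ρΓ.gluedDesc 𝒳₁.total.hom ρΓ.aut_comp) := ρΓ.isSeparated_gluedDesc hcovΓ 𝒳₁.total.hom ρΓ.aut_comp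
  haveI : IsSeparated ((baseChange (valuationSubringAtPrime K v) K).obj Q).hom := by
    change IsSeparated (pullback.snd (ρΓ.gluedDesc 𝒳₁.total.hom ρΓ.aut_comp) _)
    infer_instance
  haveI hsep₁ : ((baseChange (valuationSubringAtPrime K v) K).obj Q).left.IsSeparated :=
    ⟨by rw [← terminal.comp_from ((baseChange (valuationSubringAtPrime K v) K).obj Q).hom]; infer_instance⟩
  haveI hsep₂ : X.left.IsSeparated := ⟨by rw [← terminal.comp_from X.hom]; infer_instance⟩
  -- the canonical isomorphism of geometric quotients over `K`
  let e : ((baseChange (valuationSubringAtPrime K v) K).obj Q).left ≅ X.left := hq₁.uniqueUpToIso hq₀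
  have he₁ : ((baseChange (valuationSubringAtPrime K v) K).map ū).left ≫ e.hom = eL.hom ≫ q.left := hq₁.comp_uniqueUpToIso_hom hq₀
  have heX : e.hom ≫ X.hom = ((baseChange (valuationSubringAtPrime K v) K).obj Q).hom := by
    apply hq₁.desc_unique
    rw [reassoc_of% he₁, Over.w q,
      show eL.hom ≫ X₁.hom = ((baseChange (valuationSubringAtPrime K v) K).obj 𝒳₁.total).hom from Over.w 𝒳₁.genericIso.hom]
    exact (Over.w ((baseChange (valuationSubringAtPrime K v) K).map ū)).symm
  let 𝒳 : IntegralModel (valuationSubringAtPrime K v) K X := ⟨Q, Over.isoMk e heX⟩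
  -- smooth and proper
  have hsp : 𝒳.IsSmoothProper 1 :=
    ρΓ.smoothOfRelativeDimension_one_and_isProper_gluedDesc_of_isUnit_card hcovΓ h𝒳₁.2
      (isUnit_natCast_sections_of_isUnit' v (Nat.card Γ) hcardΓ)
      (perfectField_residueField_spec_valuationSubringAtPrime v)
  -- the descended `G`-action and its cover
  let ρ : ActionOver 𝒳.total.hom G := descAction ρΓ hcovΓ σG hcomm
  have hcovρ : ∀ x : ↥𝒳.total.left, ∃ O : ρ.StableAffineOpens, x ∈ O.1 :=
    ActionOver.exists_stableAffineOpen_descAction ρΓ hcovΓ σG hcomm (ActionOver.hcov₂_of_prod θ hcovθ)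
  have hinter : ∀ g : G, (θ.aut (1, g)).hom ≫ ū.left = ū.left ≫ (ρ.aut g).hom := fun g =>
    ActionOver.aut_hom_gluedMk_descAction ρΓ hcovΓ σG hcomm g
  -- the generic square
  have hsq : (genericFibre (valuationSubringAtPrime K v) K).map ū ≫ 𝒳.genericIso'.hom = 𝒳₁.genericIso'.hom ≫ q := by
    ext : 1
    rw [Over.comp_left, Over.comp_left]
    change ((baseChange (valuationSubringAtPrime K v) K).map ū).left ≫ e.hom = eL.hom ≫ q.left
    exact he₁
  refine ⟨𝒳, hsp, ρ, hcovρ, ū, fun γ => ρΓ.aut_hom_gluedMk hcovΓ γ, hinter, hsq, fun g t ht => ?_⟩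
  -- the generic reading of `ρ g`: precompose with the epimorphism `ū_K` (a geometric quotient)
  ext : 1
  rw [Over.comp_left, Over.comp_left]
  change ((baseChange (valuationSubringAtPrime K v) K).map (Over.isoMk (ρ.aut g) (ρ.aut_comp g)).hom).left ≫ e.hom = e.hom ≫ t.left
  apply hq₁.desc_unique
  -- LHS: `ū_K ≫ (ρ g)_K ≫ e = (θ(1,g))_K ≫ ū_K ≫ e = (θ(1,g))_K ≫ eL ≫ q = eL ≫ τ(1,g) ≫ q = eL ≫ q ≫ t`
  have h1 : ((baseChange (valuationSubringAtPrime K v) K).map ū).left ≫ ((baseChange (valuationSubringAtPrime K v) K).map (Over.isoMk (ρ.aut g) (ρ.aut_comp g)).hom).left =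
      ((baseChange (valuationSubringAtPrime K v) K).map (Over.isoMk (θ.aut (1, g)) (θ.aut_comp (1, g))).hom).left ≫ ((baseChange (valuationSubringAtPrime K v) K).map ū).left := by
    rw [← Over.comp_left, ← Over.comp_left, ← Functor.map_comp, ← Functor.map_comp]
    congr 2
    ext : 1
    rw [Over.comp_left, Over.comp_left]
    exact (hinter g).symm
  rw [reassoc_of% h1, he₁, ← Category.assoc, hτθ (1, g), Category.assoc, ht, reassoc_of% he₁]

end TameQuotientDesc

end Literature.AlgebraicGeometry.Motives

end
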